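import Summits.BirchSwinnertonDyer.BirchSwinnertonDyer.Theses.CongruentShaFreeCut
import Summits.BirchSwinnertonDyer.BirchSwinnertonDyer.Theorems.CongruentShaFreeCutTwoAdicControlOfPoitouTate
import Summits.BirchSwinnertonDyer.Rank1Residual.X11b.HalvesReceptacle
import Literature.NumberTheory.EllipticCurves.CastellaGrossiLeeSkinner2022.IMC2DivisibilityAndBDPValueFrame

set_option linter.dupNamespace false
set_option autoImplicit false

/-! # Route `CongruentShaFreeCut` (rung S2) — crux `AnalyticRankOneOfRankOneFiniteShaTwo`
(stmt-BirchSwinnertonDyer-19080), line `two-adic-bdp-triple` (v5, skeleton d5774449619c15fb):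
the three BDP-currency statements NAMED and the PLUMBING stub PROVED

Cell `bsd-cn100`, prover seat `bsd-cn100-s2-c3` (g5), on the plan seat's registered line of record
(`HOME/bsd-cn100-plan/routes-g11/bc/AnalyticRankOneOfRankOneFiniteShaTwo_twoAdicBDPTriple_v5.lean`,
STATUS 2026-08-26T10:12:08Z). Supports, does not close, stmt-BirchSwinnertonDyer-19080. HONEST
FRAMING: nothing here proves crux B, the leaf `rankOne_twoConverse_congruentNumber` or any case of
BSD. Three OPEN statements are NAMED (`@[conjecture] def`, bodies VERBATIM from the registered
skeleton, nothing asserted) and ONE registered stub — the plumbing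
`stub_heegnerNonTorsion_of_linkA_of_bdpTriple` — is PROVED with its registered name and signature.

## The three statements (OPEN at the additive prime `2`; typing model = the CGLS 2022 frames
`CastellaGrossiLeeSkinner2022/IMC2DivisibilityAndBDPValueFrame.lean` over the Literature BDP frame
`IsBDPLFunction` of `BDPAnticyclotomicPAdicLFunction.lean`)

* `TwoAdicBDPElementExists` (LB-exist) — a `2`-adic anticyclotomic BDP element `𝓛 ∈ R₀⟦T⟧` for the
  newform of `E_n` over a Heegner field `K` with `2 = v v̄` split, with an embedding datum `ι'`
  inducing `v` and CM periods `Ω_K ≠ 0`, `Ω_p ∈ R₀ˣ` (a CONSTRUCTION; X11b H1 shape).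
* `TwoAdicWanDivisibility` (LB-wan) — the `p`-CONVERSE divisibility of the anticyclotomic main
  conjecture, `2^k · j_*(char_Λ 𝔛) ⊆ (𝓛)` along every structure map `j : ℤ₂ → R₀`, for EVERY BDP
  element (the research statement of the line).
* `TwoAdicBDPValueAtOne` (LB-bdp) — the BDP formula at the trivial character,
  `𝓛(𝟙) = u · c⁻² · (1 − a₂·2⁻¹ + [2 ∤ N]·2⁻¹)² · (log_ω P_K)²`, `u ∈ R₀ˣ`, for every BDP element.

## The plumbing (PROVED, `stub_heegnerNonTorsion_of_linkA_of_bdpTriple`)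

Given the data of `HeegnerNonTorsionAtTwo` (square-free `n`; `K` imaginary quadratic with the
Heegner hypothesis for `N = N(E_n)` and for `2`; `L(E_n^{(d_K)}, 1) ≠ 0`; `rank E_n(ℚ) = 1`;
`#Ш(E_n/ℚ)[2^∞] < ∞`; a Heegner point `P` of level `N`): Kato descends the rank-one data to `K`
(`AcPConverseLinks.rank_corank_sha_baseChange_of_twist_L_one_ne_zero`); the anticyclotomic datum
`(κ, γ)`, a degree-one `𝔭 ∋ 2`, THE embedding `ι = embAt`, `v = inducedPlace ι` and the other prime
`v̄` exist (`X11b.exists_anticyclotomic_generator_degreeOnePrime`, `X11b.exists_other_prime`); Link A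
gives a generator `F` of `char_Λ 𝔛` with `F(0) ≠ 0`; `IsHeegnerPoint` unfolds to a parametrisation
datum `Dt`, a Heegner datum `H` and a complex embedding `ι_K`, and the Galois conjugate `P' = τ_* P`
(`τ ∈ Gal(K/ℚ)` with `w₀.embedding ∘ τ = ι_K`, `ComplexEmbedding.exists_comp_symm_eq_of_comp_eq`)
is the Heegner point read through THE infinite place `w₀`; (LB-exist) supplies `(ι', Ω_K, Ω_p, 𝓛)`
at `(Dt, v, κ, γ)`; (LB-wan) along the structure map `toUnr : ℤ₂ → R₀` gives
`G · 𝓛 = 2^k · toUnr_* F`, whence `𝓛(0) ≠ 0` (constant terms in `R₀ ⊂ ℂ₂`, `2^k ≠ 0`, `toUnr`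
compatible with the injective `ℚ₂ → ℂ₂`); (LB-bdp) at `P'` reads `𝓛(0) = u · (…) · (log_ω P')²`
(`UnrSeries.eq_constantCoeff_of_hasValueAt_zero`), so `log_ω P' ≠ 0`; a torsion `P` would make
`P'` torsion (`AddMonoidHom.isOfFinAddOrder`) and `log_ω P' = 0`
(`AcPConverseLinks.padicLogPoint_formalIndex_smul_eq_zero_of_isOfFinAddOrder`). No height, no
regulator, no character supply or frame rigidity is used (plan PORT NOTE 2026-08-26T10:3xZ: those
serve the ∀-forms' honesty, not this step).

References: [CastellaGrossiLeeSkinner2022] Thm. 4.2.2, §5.1–5.2, Thm. 5.1.3; [Castella2018] Thm. 2.3,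
Thm. 3.1, Thm. 3.2, Thm. 3.4; [CastellaHsieh2018] Def. 3.5, Prop. 3.6; [BertoliniDarmonPrasanna2013]
Thm. 5.13; [SilvermanAEC2009] IV.6.4, VII.2.2. -/

noncomputable section

open scoped Classical

namespace Summit.BirchSwinnertonDyer.BirchSwinnertonDyer.Theorems.CongruentShaFreeCutTwoAdicBDPTriple

open PowerSeries WeierstrassCurve NumberField IsDedekindDomain Field Literature.NumberTheory.EllipticCurves
  Literature.NumberTheory.EllipticCurves.ModularForms Literature.NumberTheory.QuadraticFields
  Literature.NumberTheory.EllipticCurves.Castella2018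
open Summit.BirchSwinnertonDyer.BirchSwinnertonDyer.Theses.CongruentShaFreeCut
open Summit.BirchSwinnertonDyer.BirchSwinnertonDyer.Theorems.CongruentShaFreeCutTwoAdicLinks
open Summit.BirchSwinnertonDyer.BirchSwinnertonDyer.Theorems.CongruentShaFreeCutOfHeegnerNonTorsion
open Literature.NumberTheory.GaloisRepresentations Literature.NumberTheory.GaloisCohomology

/-! ## 1. The three BDP-currency statements (OPEN; named, nothing asserted; bodies verbatim from
the registered skeleton d5774449619c15fb) -/

/-- **(LB-exist) a `2`-adic anticyclotomic BDP element for `E_n` over a Heegner field with `2` split**,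
X11b H1 shape: for square-free `n`, `N = N(E_n)`, `Dt` modular parametrisation data of level `N`
(`Dt.f` the newform), `K` imaginary quadratic with the Heegner hypothesis for `N` and `2 = v v̄` split,
`κ` the anticyclotomic `ℤ₂`-extension with topological generator `γ`: there is an embedding datum
`ι' : ℚ̄₂ ≃ ℂ` inducing `v` and CM periods `Ω_K ≠ 0`, `Ω_p ∈ R₀ˣ` and `𝓛 ∈ R₀⟦T⟧` with the BDP
interpolation property `IsBDPLFunction ι' v κ γ Dt.f Ω_K Ω_p 𝓛`. A CONSTRUCTION (open at the additive
prime `2`). [cite: Castella2018, Thm. 3.1 (shape; `p ≥ 5`, `p ∥ N` there)]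
[cite: CastellaHsieh2018, Def. 3.5 and Prop. 3.6 (shape; `p ∤ N` there)] -/
@[conjecture] def TwoAdicBDPElementExists : Prop :=
  ∀ ⦃n : ℕ⦄, Squarefree n →
    ∀ [(congruentNumberCurve n).IsElliptic] [(congruentNumberCurve n).IsGloballyMinimal]
      (K : Type) [Field K] [NumberField K] (N : ℕ) [NeZero N]
      (Dt : ModularParametrizationData (congruentNumberCurve n) N)
      (v : HeightOneSpectrum (𝓞 K)) (κ : ZpExtension K 2) (γ : absoluteGaloisGroup K)
      [Fact (κ.IsTopGenerator γ)],
    (congruentNumberCurve n).conductorNorm ℤ = N → IsImaginaryQuadratic K →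
    SatisfiesHeegnerHypothesis N K → ((Ideal.span {(2 : ℤ)}).primesOver (𝓞 K)).ncard = 2 →
    ((2 : ℕ) : 𝓞 K) ∈ v.asIdeal → κ.IsAnticyclotomic →
    ∃ ι' : PadicAlgCl 2 ≃+* ℂ,
      (∀ (w : InfinitePlace K) (k : 𝓞 K), k ∈ v.asIdeal ↔ ‖ι'.symm (w.embedding (k : K))‖ < 1) ∧
      ∃ (ΩK : ℂ) (Ωp : (unrIntegers 2)ˣ) (L : UnrSeries 2),
        ΩK ≠ 0 ∧ IsBDPLFunction ι' v κ γ Dt.f ΩK ((Ωp : unrIntegers 2) : ℂ_[2]) L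

/-- **(LB-wan) the `p`-converse divisibility of the `2`-adic anticyclotomic main conjecture for `E_n`**:
with the data of (LB-exist), `v̄ ≠ v` the other prime above `2` (the strict place of Castella's Selmer
group `𝔛 = X_ac^∅`), for EVERY BDP element `(ι', Ω_K, Ω_p, 𝓛)` of the frame and every structure map
`j : ℤ₂ → R₀`: `2^k · j_*(char_Λ 𝔛) ⊆ (𝓛)` for some `k` — the Skinner–Urban / Wan (Eisenstein
congruence) direction, the one a converse theorem consumes. Vacuous where `𝔛` is not torsion
(`char = 0`); invariant under `𝓛 ↦ unit · 𝓛`. OPEN at `p = 2` (in print: `p ∤ 2N`).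
[cite: CastellaGrossiLeeSkinner2022, Thm. 4.2.2 and §5.3 (shape of the OTHER divisibility; nothing asserted)]
[cite: Castella2018, Thm. 3.4 (shape; nothing asserted)] -/
@[conjecture] def TwoAdicWanDivisibility : Prop :=
  ∀ ⦃n : ℕ⦄, Squarefree n →
    ∀ [(congruentNumberCurve n).IsElliptic] [(congruentNumberCurve n).IsGloballyMinimal]
      (ι' : PadicAlgCl 2 ≃+* ℂ) (K : Type) [Field K] [NumberField K] (N : ℕ) [NeZero N]
      (Dt : ModularParametrizationData (congruentNumberCurve n) N)
      (v vbar : HeightOneSpectrum (𝓞 K)) (κ : ZpExtension K 2) (γ : absoluteGaloisGroup K)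
      [Fact (κ.IsTopGenerator γ)],
    (congruentNumberCurve n).conductorNorm ℤ = N → IsImaginaryQuadratic K →
    SatisfiesHeegnerHypothesis N K → ((Ideal.span {(2 : ℤ)}).primesOver (𝓞 K)).ncard = 2 →
    (∀ (w : InfinitePlace K) (k : 𝓞 K), k ∈ v.asIdeal ↔ ‖ι'.symm (w.embedding (k : K))‖ < 1) →
    ((2 : ℕ) : 𝓞 K) ∈ vbar.asIdeal → vbar ≠ v → κ.IsAnticyclotomic →
    ∀ (ΩK : ℂ) (Ωp : (unrIntegers 2)ˣ) (L : UnrSeries 2),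
      ΩK ≠ 0 → IsBDPLFunction ι' v κ γ Dt.f ΩK ((Ωp : unrIntegers 2) : ℂ_[2]) L →
    ∀ (j : ℤ_[2] →+* unrIntegers 2),
      (∀ x : ℤ_[2], ((j x : unrIntegers 2) : ℂ_[2]) = algebraMap ℚ_[2] ℂ_[2] (x : ℚ_[2])) →
      ∃ k : ℕ, ∀ F ∈ AcSelmer.XAc.charIdeal ((congruentNumberCurve n).baseChange K) 2 κ vbar ∅ γ,
        C ((2 : unrIntegers 2) ^ k) * PowerSeries.map j F ∈ Ideal.span {L}

/-- **(LB-bdp) the BDP formula at the trivial character for `E_n` at the additive prime `2`**: with the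
data of (LB-exist), `H` a Heegner datum of level `N` and discriminant `d_K`, `w` the infinite place,
`e : K → ℚ₂` inducing `v`, `P ∈ E_n(K)` THE Heegner point `w(P) = heegnerPointComplex Dt H`, for EVERY
BDP element of the frame: `𝓛(𝟙) = u · c⁻² · (1 − a₂·2⁻¹ + [2 ∤ N]·2⁻¹)² · (log_ω P)²` with `u ∈ R₀ˣ`
(`a₂ = (E_n).LFunction 2`, the Dirichlet coefficient; `c` the Manin-type constant of `Dt`;
`log_ω = padicLogOmega`). OPEN at `p = 2 ∣ N` (in print: `p ∤ 2N`, CGLS 2022 Thm. 5.1.3 / BDP 2013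
Thm. 5.13; the Kriz–Li 2019 congruence Thm. 1.16 holds at any prime but is not this formula).
[cite: CastellaGrossiLeeSkinner2022, Thm. 5.1.3 (shape; `p ∤ 2N` there; nothing asserted)]
[cite: BertoliniDarmonPrasanna2013, Thm. 5.13 (shape; nothing asserted)] -/
@[conjecture] def TwoAdicBDPValueAtOne : Prop :=
  ∀ ⦃n : ℕ⦄, Squarefree n →
    ∀ [(congruentNumberCurve n).IsElliptic] [(congruentNumberCurve n).IsGloballyMinimal]
      (ι' : PadicAlgCl 2 ≃+* ℂ) (K : Type) [Field K] [NumberField K] (N : ℕ) [NeZero N]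
      (Dt : ModularParametrizationData (congruentNumberCurve n) N)
      (H : HeegnerDatum N (NumberField.discr K)) (w : InfinitePlace K) (e : K →+* ℚ_[2])
      (v : HeightOneSpectrum (𝓞 K)) (κ : ZpExtension K 2) (γ : absoluteGaloisGroup K)
      [Fact (κ.IsTopGenerator γ)] (P : ((congruentNumberCurve n).baseChange K).toAffine.Point),
    (congruentNumberCurve n).conductorNorm ℤ = N → IsImaginaryQuadratic K →
    SatisfiesHeegnerHypothesis N K → ((Ideal.span {(2 : ℤ)}).primesOver (𝓞 K)).ncard = 2 →
    ((2 : ℕ) : 𝓞 K) ∈ v.asIdeal →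
    (∀ (w' : InfinitePlace K) (k : 𝓞 K), k ∈ v.asIdeal ↔ ‖ι'.symm (w'.embedding (k : K))‖ < 1) →
    κ.IsAnticyclotomic →
    WeierstrassCurve.Affine.Point.map w.embedding.toRatAlgHom P = heegnerPointComplex Dt H →
    (∀ k : 𝓞 K, k ∈ v.asIdeal ↔ ‖e (k : K)‖ < 1) →
    ∀ (ΩK : ℂ) (Ωp : (unrIntegers 2)ˣ) (L : UnrSeries 2),
      ΩK ≠ 0 → IsBDPLFunction ι' v κ γ Dt.f ΩK ((Ωp : unrIntegers 2) : ℂ_[2]) L →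
      ∃ u : (unrIntegers 2)ˣ, L.HasValueAt 0
        (((u : unrIntegers 2) : ℂ_[2]) *
          algebraMap ℚ_[2] ℂ_[2] (((Dt.c : ℚ_[2])⁻¹) ^ 2 *
            (1 - ((congruentNumberCurve n).LFunction 2 : ℚ_[2]) * (2 : ℚ_[2])⁻¹ +
              (if (2 : ℕ) ∣ N then 0 else (2 : ℚ_[2])⁻¹)) ^ 2 *
            (padicLogOmega (congruentNumberCurve n) 2 e P) ^ 2))

/-! ## 2. The plumbing stub (PROVED; registered name and signature) -/

/-- **`stub_heegnerNonTorsion_of_linkA_of_bdpTriple`** (registered stub of line `two-adic-bdp-triple`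
v5 on stmt-BirchSwinnertonDyer-19080; size M, PLUMBING — proved from tree material): Kato (`hKato`,
rank/Ш of `E_n/K` from the twist value), Link A (`hA`: a generator `F` of `char_Λ 𝔛` with
`F(0) ≠ 0`, `HasCharValuationAt`), (LB-exist) (`hE`: the datum `ι'` and `𝓛`), (LB-wan) (`hWan`,
along the structure map `toUnr : ℤ₂ → R₀`: `G · 𝓛 = 2^k · toUnr_* F`, constant terms in the domain
`R₀ ⊂ ℂ₂`: `𝓛(0) ≠ 0`) and (LB-bdp) (`hV`: `𝓛(0) = u·c⁻²·(…)²·(log_ω P')²`,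
`UnrSeries.eq_constantCoeff_of_hasValueAt_zero`) give `log_ω P' ≠ 0` for the Galois conjugate
`P' = τ_* P` of the Heegner point that is read through THE infinite place, hence `P'` and so `P`
non-torsion (the logarithm of a torsion point vanishes). CONDITIONAL on the four named inputs;
credits nothing beyond the registered plumbing.
[cite: Castella2018, proof of Thm. 2.3 with Thm. 3.4 (the shape of this step)]
[cite: CastellaGrossiLeeSkinner2022, §5.2 (proof of Thm. 5.2.1)] [cite: SilvermanAEC2009, IV.6.4 and VII.2.2] -/
theorem stub_heegnerNonTorsion_of_linkA_of_bdpTriple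
    (hKato : ∀ (W : WeierstrassCurve ℚ) [W.IsElliptic] (p : ℕ) [Fact p.Prime],
      kato_finite_of_L_one_ne_zero W p)
    (hA : TwoAdicControlOfRankOne) (hE : TwoAdicBDPElementExists) (hWan : TwoAdicWanDivisibility)
    (hV : TwoAdicBDPValueAtOne) : HeegnerNonTorsionAtTwo := by
  intro n hsq K _ _ N _ hN hK hHN hH2 hL hrank hsha P hP
  haveI := isElliptic_congruentNumberCurve hsq.ne_zero
  haveI := isGloballyMinimal_congruentNumberCurve hsq
  -- (0) `2 = v v̄` splits in `K`
  have hsplit : ((Ideal.span {(2 : ℤ)}).primesOver (𝓞 K)).ncard = 2 := by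
    simpa using hH2 2 Nat.prime_two (dvd_refl 2)
  -- (1) the rank-one data over `K` (Kato on the twist)
  obtain ⟨hrk, -, hshaK⟩ := AcPConverseLinks.rank_corank_sha_baseChange_of_twist_L_one_ne_zero
    hKato (congruentNumberCurve n) 2 hK hL hrank hsha
  -- (2) the anticyclotomic datum `(κ, γ)`, THE embedding at a degree-one `𝔭 ∋ 2`, `v`, `v̄`
  obtain ⟨κ, γ, 𝔭, hκ, hγ, h𝔭, he, hf⟩ :=
    Summit.BirchSwinnertonDyer.Rank1Residual.X11b.exists_anticyclotomic_generator_degreeOnePrime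
      2 K hK hH2
  haveI : Fact (κ.IsTopGenerator γ) := ⟨hγ⟩
  set ι : K →+* ℚ_[2] := Summit.BirchSwinnertonDyer.Rank1Residual.X11b.embAt K 2 𝔭 h𝔭 he hf
    with hιdef
  set v := Summit.BirchSwinnertonDyer.Rank1Residual.X11b.inducedPlace ι with hvdef
  have hv : ∀ x : 𝓞 K, x ∈ v.asIdeal ↔ ‖ι (x : K)‖ < 1 :=
    Summit.BirchSwinnertonDyer.Rank1Residual.X11b.mem_inducedPlace_iff ι
  have hv2 : ((2 : ℕ) : 𝓞 K) ∈ v.asIdeal :=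
    Summit.BirchSwinnertonDyer.Rank1Residual.X11b.natCast_mem_inducedPlace ι
  obtain ⟨vbar, hvbar, hne⟩ :=
    Summit.BirchSwinnertonDyer.Rank1Residual.X11b.exists_other_prime hH2 v hv2
  -- (3) Link A at this datum: a generator `F` of `char_Λ 𝔛` with `F(0) ≠ 0`
  obtain ⟨m, -, F, hF, hF0, -⟩ :=
    hA hsq K N hN hK hHN hH2 ι v vbar hv hvbar hne κ hκ γ hrk hshaK
  -- (4) the Heegner datum of `P`; the Galois conjugate `P'` read through THE infinite place `w₀`
  obtain ⟨Dt, H, ιK, hPι⟩ := hP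
  obtain ⟨w₀⟩ := (inferInstance : Nonempty (InfinitePlace K))
  haveI : IsGalois ℚ K := by
    haveI : Algebra.IsQuadraticExtension ℚ K := ⟨hK.1⟩
    infer_instance
  obtain ⟨σ, hσ⟩ := ComplexEmbedding.exists_comp_symm_eq_of_comp_eq (k := ℚ) w₀.embedding ιK
    (by ext x; simp)
  set τ : K →+* K := ((σ.symm : K ≃ₐ[ℚ] K) : K →+* K) with hτdef
  set P' := WeierstrassCurve.Affine.Point.map τ.toRatAlgHom P with hP'def
  have hP' : WeierstrassCurve.Affine.Point.map w₀.embedding.toRatAlgHom P' =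
      heegnerPointComplex Dt H := by
    rw [hP'def, WeierstrassCurve.Affine.Point.map_map]
    have hcomp : w₀.embedding.toRatAlgHom.comp τ.toRatAlgHom = ιK.toRatAlgHom := by
      apply AlgHom.ext
      intro x
      have := RingHom.congr_fun hσ x
      simpa [hτdef] using this
    rw [hcomp]
    exact hPι
  -- (5) (LB-exist): the BDP element at `(Dt, v, κ, γ)`
  obtain ⟨ι', hι', ΩK, Ωp, L, hΩK, hBDP⟩ := hE hsq K N Dt v κ γ hN hK hHN hsplit hv2 hκ
  -- (6) (LB-wan) along the structure map `toUnr : ℤ₂ → R₀` forces `𝓛(0) ≠ 0`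
  obtain ⟨k, hk⟩ := hWan hsq ι' K N Dt v vbar κ γ hN hK hHN hsplit hι' hvbar hne hκ ΩK Ωp L hΩK
    hBDP (Summit.BirchSwinnertonDyer.Rank1Residual.X11b.Halves.toUnr 2)
    (Summit.BirchSwinnertonDyer.Rank1Residual.X11b.Halves.coe_toUnr 2)
  have hFmem : F ∈ AcSelmer.XAc.charIdeal ((congruentNumberCurve n).baseChange K) 2 κ vbar ∅ γ := by
    rw [hF]; exact Ideal.mem_span_singleton_self F
  obtain ⟨G, hG⟩ := Ideal.mem_span_singleton'.mp (hk F hFmem)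
  have hL0 : PowerSeries.constantCoeff L ≠ 0 := by
    intro h0
    have h1 := congrArg (fun S : UnrSeries 2 ↦ ((PowerSeries.constantCoeff S : unrIntegers 2) : ℂ_[2])) hG
    simp only [map_mul, h0, mul_zero, PowerSeries.constantCoeff_C,
      Summit.BirchSwinnertonDyer.Rank1Residual.X11b.CongruenceLimit.constantCoeff_map_apply, Subring.coe_mul, Subring.coe_pow, Subring.coe_zero,
      Summit.BirchSwinnertonDyer.Rank1Residual.X11b.Halves.coe_toUnr] at h1
    -- h1 : 0 = 2 ^ k * algebraMap ℚ_[2] ℂ_[2] (constantCoeff F)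
    have h2 : ((2 : unrIntegers 2) : ℂ_[2]) = (2 : ℂ_[2]) := by norm_cast
    rw [h2] at h1
    have h3 : algebraMap ℚ_[2] ℂ_[2] ((PowerSeries.constantCoeff F : ℤ_[2]) : ℚ_[2]) = 0 := by
      rcases mul_eq_zero.mp h1.symm with h | h
      · exact absurd (pow_eq_zero_iff'.mp h).1 two_ne_zero
      · exact h
    rw [map_eq_zero_iff _ (algebraMap ℚ_[2] ℂ_[2]).injective] at h3
    exact hF0 (PadicInt.coe_eq_zero.mp h3)
  -- (7) (LB-bdp) at `P'`: `𝓛(0) = u · c⁻² · (…)² · (log_ω P')²`, so `log_ω P' ≠ 0`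
  have hv' : ∀ x : 𝓞 K, x ∈ v.asIdeal ↔ ‖ι (x : K)‖ < 1 := hv
  obtain ⟨u, hu⟩ := hV hsq ι' K N Dt H w₀ ι v κ γ P' hN hK hHN hsplit hv2 hι' hκ hP' hv' ΩK Ωp L
    hΩK hBDP
  have hval := UnrSeries.eq_constantCoeff_of_hasValueAt_zero hu
  -- (8) a torsion `P` makes `P'` torsion and `log_ω P' = 0`, contradicting `𝓛(0) ≠ 0`
  intro hPtor
  have hP'tor : IsOfFinAddOrder P' := by
    rw [hP'def]
    exact AddMonoidHom.isOfFinAddOrder _ hPtor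
  have hlog : padicLogOmega (congruentNumberCurve n) 2 ι P' = 0 := by
    unfold padicLogOmega
    rw [AcPConverseLinks.padicLogPoint_formalIndex_smul_eq_zero_of_isOfFinAddOrder
      (congruentNumberCurve n) 2 ι hP'tor, zero_div]
  apply hL0
  rw [hlog, zero_pow two_ne_zero, mul_zero, map_zero, mul_zero] at hval
  exact_mod_cast hval.symm

/-! ## 3. The kernel census of crux B after v5 (appended 2026-08-26, bsd-cn100-s2-c3 g5): crux B ⟸
(LB-exist) + (LB-wan) + (LB-bdp) + Poitou–Tate + six refereed facts — in ONE theorem, and with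
Poitou–Tate demanded at IMAGINARY QUADRATIC fields only (the currency of the Link A landing
`twoAdicControlOfRankOne_of_poitouTate_imaginaryQuadratic`, p432373) -/

/-- **Crux B of S2 from the BDP triple, modulo Poitou–Tate at imaginary quadratic fields and six
refereed facts.** `2`-parity (`hpar`), Modularity (`hmod`), Hoffstein–Luo (`hHL`), Kato (`hKato`),
existence of Heegner points (`hHP`, Gross 1984), Gross–Zagier + Kolyvagin (`hGZ`), Poitou–Tate's
nine-term duality at every imaginary quadratic field (`hPT`, Milne ADT I 4.10(b) — the textbook
input under Link A; the (F1) campaign's first milestone), and the three OPEN BDP-currency statements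
(LB-exist) `hE`, (LB-wan) `hWan`, (LB-bdp) `hV` give `AnalyticRankOneOfRankOneFiniteShaTwo`:
the plumbing `stub_heegnerNonTorsion_of_linkA_of_bdpTriple` fed with Link A :=
`twoAdicControlOfRankOne_of_poitouTate_imaginaryQuadratic hPT` (p432373), then the landed v2
composition `analyticRankOne_of_facts_of_heegnerNonTorsion` (p419056). This is the attacked crux's
KERNEL CENSUS after the v5 re-cut (= the registered skeleton composition with the two closed inputs
inlined): the research content of stmt-BirchSwinnertonDyer-19080 is EXACTLY (LB-exist) + (LB-wan) +
(LB-bdp) at the additive prime `2`. CONDITIONAL; credits nothing; proves no case of BSD.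
[cite: MilneADT2006, Ch. I, Thm. 4.10(b) with Cor. 2.3] [cite: GrossZagier1986, Thm. I.6.3 with V.§2]
[cite: CastellaGrossiLeeSkinner2022, §5.2 (proof of Thm. 5.2.1: the shape of a BDP-type p-converse)] -/
theorem cruxB_of_bdpTriple_of_poitouTate_imaginaryQuadratic
    (hpar : ∀ (W : WeierstrassCurve ℚ) [W.IsElliptic] (p : ℕ) [Fact p.Prime], p_parity W p)
    (hmod : ModularForms.exists_isNewformOf) (hHL : HoffsteinLuo1997_exists_twist_L_one_ne_zero)
    (hKato : ∀ (W : WeierstrassCurve ℚ) [W.IsElliptic] (p : ℕ) [Fact p.Prime],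
      kato_finite_of_L_one_ne_zero W p)
    (hHP : ∀ (W : WeierstrassCurve ℚ) (K : Type) [Field K] [NumberField K],
      exists_isHeegnerPoint W K)
    (hGZ : ∀ (W : WeierstrassCurve ℚ) (N : ℕ) [NeZero N] (K : Type) [Field K] [NumberField K],
      analyticRankEK_eq_one_iff_heegner_nonTorsion W N K)
    (hPT : ∀ (K : Type) [Field K] [NumberField K], IsImaginaryQuadratic K →
      poitouTate_sum_localTatePairing_eq_zero K)
    (hE : TwoAdicBDPElementExists) (hWan : TwoAdicWanDivisibility) (hV : TwoAdicBDPValueAtOne) :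
    AnalyticRankOneOfRankOneFiniteShaTwo :=
  analyticRankOne_of_facts_of_heegnerNonTorsion hpar hmod hHL hKato hHP hGZ
    (stub_heegnerNonTorsion_of_linkA_of_bdpTriple hKato
      (CongruentShaFreeCutTwoAdicControlOfPoitouTate.twoAdicControlOfRankOne_of_poitouTate_imaginaryQuadratic
        hPT) hE hWan hV)

/-- **Crux B of S2 from the BDP triple, modulo Poitou–Tate (every number field) and six refereed
facts** — the binder shape of the registered `stub_textbookDuality` (token-identical `∀ K`), by
specialising `cruxB_of_bdpTriple_of_poitouTate_imaginaryQuadratic`. CONDITIONAL; credits nothing.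
[cite: MilneADT2006, Ch. I, Thm. 4.10(b) with Cor. 2.3] [cite: GrossZagier1986, Thm. I.6.3 with V.§2] -/
theorem cruxB_of_bdpTriple_of_poitouTate
    (hpar : ∀ (W : WeierstrassCurve ℚ) [W.IsElliptic] (p : ℕ) [Fact p.Prime], p_parity W p)
    (hmod : ModularForms.exists_isNewformOf) (hHL : HoffsteinLuo1997_exists_twist_L_one_ne_zero)
    (hKato : ∀ (W : WeierstrassCurve ℚ) [W.IsElliptic] (p : ℕ) [Fact p.Prime],
      kato_finite_of_L_one_ne_zero W p)
    (hHP : ∀ (W : WeierstrassCurve ℚ) (K : Type) [Field K] [NumberField K],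
      exists_isHeegnerPoint W K)
    (hGZ : ∀ (W : WeierstrassCurve ℚ) (N : ℕ) [NeZero N] (K : Type) [Field K] [NumberField K],
      analyticRankEK_eq_one_iff_heegner_nonTorsion W N K)
    (hPT : ∀ (K : Type) [Field K] [NumberField K], poitouTate_sum_localTatePairing_eq_zero K)
    (hE : TwoAdicBDPElementExists) (hWan : TwoAdicWanDivisibility) (hV : TwoAdicBDPValueAtOne) :
    AnalyticRankOneOfRankOneFiniteShaTwo :=
  cruxB_of_bdpTriple_of_poitouTate_imaginaryQuadratic hpar hmod hHL hKato hHP hGZ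
    (fun K _ _ _ ↦ hPT K) hE hWan hV

end Summit.BirchSwinnertonDyer.BirchSwinnertonDyer.Theorems.CongruentShaFreeCutTwoAdicBDPTriple

end
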